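import Literature.MathematicalPhysics.StatisticalMechanics.BarlowStacking
import Literature.Algebra.EuclideanLattices.FccBccLattices
import HarnessLib

/-!
# Covering radius of a Barlow stacking: every point of space is within `1/√2` of the packing

HONEST FRAMING. Part of the venture `Summits/Ventures/Crystal3D` (cell `crystal3d-full`), helper for the
crux `GenericWallFloor` (stmt-Ventures-19480) of `route-Ventures-StickyWulffConstant`, line `WallLedgerG`,
module M4 ("sealing") of the rigid-bicrystal rung (RIGID-RUNG-ARCH on the item): a foreign ball cannot sit
inside a slab filled by a grain, because every point of space is within distance `1/√2 < 1` of some ball of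
ANY Barlow stacking (unit balls, layer spacing `√(2/3)`).  Rung credit only.

Proof: the nearest layer is at vertical distance `≤ ½√(2/3)` (square `≤ 1/6`); inside a layer — a
translated unit triangular lattice — every point of the plane is within `1/√3` (square `≤ 1/3`) of a lattice
point: in the coordinates `α u + β v` of the layer the fractional parts `(s, t)` lie in a unit cell made of
two equilateral triangles, and for the lower triangle the barycentric identity
`(1−s−t)·q(s,t) + s·q(s−1,t) + t·q(s,t−1) = 1/3 − q(s−⅓, t−⅓)` (`q(x,y) = x² + xy + y²` the squared length of
`x u + y v`) bounds the smallest of the three squared vertex distances by `1/3` (upper triangle by symmetry).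
-/

noncomputable section

namespace Summit.Ventures.Crystal3D.Theorems

open Literature.MathematicalPhysics.StatisticalMechanics (barlowPos barlowStacking haggLabel barlowPos_mem
  barlowPos_apply_zero barlowPos_apply_one barlowPos_apply_two)
open Literature.Algebra.EuclideanLattices (norm_sq_fin_three)

/-- The hexagonal quadratic form `q(x, y) = x² + xy + y² = ‖x u + y v‖²`. -/
private theorem hexForm_triangle_lower (s t : ℝ) (hs : 0 ≤ s) (ht : 0 ≤ t) (hst : s + t ≤ 1) :
    s ^ 2 + s * t + t ^ 2 ≤ 1 / 3 ∨ (s - 1) ^ 2 + (s - 1) * t + t ^ 2 ≤ 1 / 3 ∨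
      s ^ 2 + s * (t - 1) + (t - 1) ^ 2 ≤ 1 / 3 := by
  by_contra hcon
  push Not at hcon
  obtain ⟨h₀, h₁, h₂⟩ := hcon
  -- barycentric identity: (1-s-t) q₀ + s q₁ + t q₂ = 1/3 - q(s - 1/3, t - 1/3) ≤ 1/3
  have hid : (1 - s - t) * (s ^ 2 + s * t + t ^ 2) + s * ((s - 1) ^ 2 + (s - 1) * t + t ^ 2) +
      t * (s ^ 2 + s * (t - 1) + (t - 1) ^ 2) =
      1 / 3 - ((s - 1 / 3) ^ 2 + (s - 1 / 3) * (t - 1 / 3) + (t - 1 / 3) ^ 2) := by ring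
  have hq : 0 ≤ (s - 1 / 3) ^ 2 + (s - 1 / 3) * (t - 1 / 3) + (t - 1 / 3) ^ 2 := by
    nlinarith [sq_nonneg (s - 1 / 3 + (t - 1 / 3) / 2), sq_nonneg (t - 1 / 3)]
  nlinarith [mul_le_mul_of_nonneg_left h₀.le (by linarith : (0 : ℝ) ≤ 1 - s - t),
    mul_le_mul_of_nonneg_left h₁.le hs, mul_le_mul_of_nonneg_left h₂.le ht]

/-- In the unit cell `0 ≤ s, t < 1` of the triangular lattice some vertex `(a', b') ∈ {0,1}²` is within
squared hexagonal distance `1/3`. -/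
private theorem hexForm_cell (s t : ℝ) (hs : 0 ≤ s) (hs1 : s ≤ 1) (ht : 0 ≤ t) (ht1 : t ≤ 1) :
    ∃ a' b' : ℤ, (a' = 0 ∨ a' = 1) ∧ (b' = 0 ∨ b' = 1) ∧
      (s - a') ^ 2 + (s - a') * (t - b') + (t - b') ^ 2 ≤ 1 / 3 := by
  by_cases hst : s + t ≤ 1
  · rcases hexForm_triangle_lower s t hs ht hst with h | h | h
    · exact ⟨0, 0, Or.inl rfl, Or.inl rfl, by push_cast; simpa using h⟩
    · exact ⟨1, 0, Or.inr rfl, Or.inl rfl, by push_cast; simpa using h⟩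
    · exact ⟨0, 1, Or.inl rfl, Or.inr rfl, by push_cast; simpa using h⟩
  · -- upper triangle: apply the lower case to (1 - s, 1 - t)
    push Not at hst
    rcases hexForm_triangle_lower (1 - s) (1 - t) (by linarith) (by linarith) (by linarith) with h | h | h
    · refine ⟨1, 1, Or.inr rfl, Or.inr rfl, ?_⟩; push_cast; nlinarith [h]
    · refine ⟨0, 1, Or.inl rfl, Or.inr rfl, ?_⟩; push_cast; nlinarith [h]
    · refine ⟨1, 0, Or.inr rfl, Or.inl rfl, ?_⟩; push_cast; nlinarith [h]

/-- **Covering radius of a Barlow stacking.**  For every Hägg-coded stacking with unit balls and layer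
spacing `√(2/3)` and every point `x ∈ ℝ³` there is a ball centre `p` of the stacking with
`dist x p ^ 2 ≤ 1/2`, i.e. `dist x p ≤ 1/√2`. -/
theorem exists_mem_barlowStacking_dist_sq_le_half (σ : ℤ → ℤ) (x : EuclideanSpace ℝ (Fin 3)) :
    ∃ p ∈ barlowStacking 1 (Real.sqrt (2 / 3)) σ, dist x p ^ 2 ≤ 1 / 2 := by
  have hh_pos : 0 < Real.sqrt (2 / 3) := Real.sqrt_pos.2 (by norm_num)
  have hh_sq : Real.sqrt (2 / 3) ^ 2 = 2 / 3 := Real.sq_sqrt (by norm_num)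
  -- nearest layer `k`
  obtain ⟨k, hk⟩ : ∃ k : ℤ, |x 2 / Real.sqrt (2 / 3) - k| ≤ 1 / 2 := ⟨_, abs_sub_round _⟩
  have hvert : (x 2 - k * Real.sqrt (2 / 3)) ^ 2 ≤ 1 / 6 := by
    have h2 : x 2 - k * Real.sqrt (2 / 3) = Real.sqrt (2 / 3) * (x 2 / Real.sqrt (2 / 3) - k) := by
      rw [mul_sub, mul_div_cancel₀ _ hh_pos.ne']; ring
    obtain ⟨hlo, hhi⟩ := abs_le.1 hk
    rw [h2, mul_pow, hh_sq]
    nlinarith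
  -- the layer's letter offset and in-layer coordinates `x = α u + β v + L w + (height)`
  obtain ⟨L, hL⟩ : ∃ L : ℝ, ((haggLabel σ k : ℤ) : ℝ) = L := ⟨_, rfl⟩
  have hc_pos : 0 < Real.sqrt 3 / 2 := by positivity
  have hc_sq : (Real.sqrt 3 / 2) ^ 2 = 3 / 4 := by
    rw [div_pow, Real.sq_sqrt (by norm_num)]; norm_num
  obtain ⟨β, hx1⟩ : ∃ β : ℝ, x 1 = Real.sqrt 3 / 2 * (β + L / 3) := by
    refine ⟨x 1 / (Real.sqrt 3 / 2) - L / 3, ?_⟩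
    rw [sub_add_cancel, mul_div_cancel₀ _ hc_pos.ne']
  obtain ⟨α, hx0⟩ : ∃ α : ℝ, x 0 = α + β / 2 + L / 2 := ⟨x 0 - β / 2 - L / 2, by ring⟩
  obtain ⟨i, hs0, hs1⟩ : ∃ i : ℤ, 0 ≤ α - i ∧ α - i ≤ 1 :=
    ⟨⌊α⌋, by linarith [Int.floor_le α], by linarith [Int.lt_floor_add_one α]⟩
  obtain ⟨j, ht0, ht1⟩ : ∃ j : ℤ, 0 ≤ β - j ∧ β - j ≤ 1 :=
    ⟨⌊β⌋, by linarith [Int.floor_le β], by linarith [Int.lt_floor_add_one β]⟩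
  obtain ⟨a', b', -, -, hq⟩ := hexForm_cell (α - i) (β - j) hs0 hs1 ht0 ht1
  refine ⟨barlowPos 1 (Real.sqrt (2 / 3)) σ k (i + a') (j + b'), barlowPos_mem _ _ _, ?_⟩
  -- the three coordinate differences
  have hd0 : (x - barlowPos 1 (Real.sqrt (2 / 3)) σ k (i + a') (j + b')) 0 =
      (α - i - a') + (β - j - b') / 2 := by
    rw [PiLp.sub_apply, barlowPos_apply_zero, hx0, hL]; push_cast; ring
  have hd1 : (x - barlowPos 1 (Real.sqrt (2 / 3)) σ k (i + a') (j + b')) 1 =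
      Real.sqrt 3 / 2 * (β - j - b') := by
    rw [PiLp.sub_apply, barlowPos_apply_one, hx1, hL]; push_cast; ring
  have hd2 : (x - barlowPos 1 (Real.sqrt (2 / 3)) σ k (i + a') (j + b')) 2 =
      x 2 - k * Real.sqrt (2 / 3) := by
    rw [PiLp.sub_apply, barlowPos_apply_two]
  rw [dist_eq_norm, norm_sq_fin_three, hd0, hd1, hd2, mul_pow, hc_sq]
  nlinarith [hq, hvert]

/-- **Sealing.**  Every point of space is at distance `< 1` from some ball of any Barlow stacking (in
particular no unit ball disjoint from the packing fits anywhere: the stacking is saturated). -/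
theorem exists_mem_barlowStacking_dist_lt_one (σ : ℤ → ℤ) (x : EuclideanSpace ℝ (Fin 3)) :
    ∃ p ∈ barlowStacking 1 (Real.sqrt (2 / 3)) σ, dist x p < 1 := by
  obtain ⟨p, hp, h⟩ := exists_mem_barlowStacking_dist_sq_le_half σ x
  exact ⟨p, hp, by nlinarith [dist_nonneg (x := x) (y := p)]⟩

end Summit.Ventures.Crystal3D.Theorems

end
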